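import Summits.PneNP.PneNP.Theorems.SzkEntropyPeaWorstToAvgDualModeCompileAdviceElimMachineA

/-!
# Route SzkEntropy, crux `PeaWorstToAvg` (stmt-PneNP-10777), line `dual-mode-compile`, stub `stub_adviceElim`:
# the bricks of the uniform scheme (III): error counts, selection of the first passing candidate, the scheme

Support file (6) for the stub `stub_adviceElim` (advice elimination by labelled self-testing): the last part
of the uniform scheme `U` as a total `FP` string function, and `U` itself as a `RandAlg` with an HONEST
POLYNOMIAL coin budget.  On `x = ⟨⟨e, R⟩, 1ᶜ⟩`:

* `errSumF` — the empirical error count `bin (errCount c R)` of candidate `c` (the counted sum `sumF` of the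
  error bits `errPieceZ`); `passF` — the pass bit `[errCount c R ≤ τ]`; `predF` — the candidate's vote on the
  padded input query over the output block; `candF` — the record `[pass, vote]`;
* `firstOp`, `foldAcc_firstOp` — the fold keeping the record of the FIRST passing candidate (model:
  `List.find?`), `outBitF` — **the answer bit** `[out (pm n m) y R]` of `…AdviceElimExperiment.lean`
  (`outBitF_apply`, `outBitF_mem_FP`);
* **`uScheme mp S A`** — the uniform scheme: run `out`, coin budget the polynomial `MParams.coins`;
  `uScheme_isPolyTime`, `uScheme_coinLen`, and `uScheme_pr_eq` — its error probability on `(y, 1ⁿ, 1ᵐ)` is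
  the counting probability of `{R | out(y; R) ≠ label}` over the coins actually read.

References: S. Arora, B. Barak (2009), §1.3, Thm. 7.10; A. Bogdanov, L. Trevisan (2006), Def. 2.12–2.13;
R. Impagliazzo, A. Wigderson, JCSS 63 (2001), Lemma 14 ("output the first that passes").
-/

noncomputable section

open _root_.Computability
open Literature.Computability.Complexity Literature.Computability.Complexity.Brick
open Literature.Computability.Complexity.Plumb Literature.Computability.Complexity.HashBricks
open Literature.Computability.MetaComplexity
open Finset Polynomial

namespace Summit.PneNP.PneNP.Cruxes.PeaWorstToAvg.DualModeCompile

set_option linter.dupNamespace false -- `Summit.PneNP.PneNP.…`: summit = sub-problem name (D-0017 single-conjunct layout)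

namespace AdviceElim

variable (mp : MParams) (S : Bool → RandAlg ℕ (List Bool)) (A : RandAlg (List Bool × ℕ × ℕ) Bool)

/-! ### On `x = ⟨⟨e, R⟩, 1ᶜ⟩`: the error count, the pass bit, the prediction -/

/-- `x ↦ e`. [folklore] -/
def eX : List Bool → List Bool := fstF ∘ fstF

/-- `x ↦ R`. [folklore] -/
def rX : List Bool → List Bool := sndF ∘ fstF

/-- **The empirical error count** `bin (errCount c R)` of candidate `c`: the counted sum of its error bits on
its `N` sample blocks. [ImpagliazzoWigderson2001, Lemma 14 (proof)] -/
def errSumF : List Bool → List Bool := sumF (errPieceZ mp S A) (NU mp ∘ eX) mp.Np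

/-- **The pass bit** `[errCount c R ≤ τ]`. [ImpagliazzoWigderson2001, Lemma 14 (proof)] -/
def passF : List Bool → List Bool := notFn (ltFn ∘ fanoutFn (lenBinF ∘ τU mp ∘ eX) (errSumF mp S A))

/-- `x ↦` the output block `outZ`. [folklore] -/
def outZX : List Bool → List Bool := takeFn ∘ fanoutFn (kPU mp ∘ eX) (dropFn ∘ fanoutFn (testLenU mp ∘ eX) rX)

/-- `x ↦ ⟨padded input query, ⟨1ᶜ, ⟨1ᵏ, output block⟩⟩⟩`, the argument of `majF`. [folklore] -/
def predArgX : List Bool → List Bool :=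
  fanoutFn (qOfF mp ∘ fanoutFn (fstF ∘ eX) eX) (fanoutFn sndF (fanoutFn (kU mp ∘ eX) (outZX mp)))

/-- **The prediction** of candidate `c`: its majority vote on the padded input query over the output block.
[BogdanovTrevisan2006, Def. 2.12] -/
def predF : List Bool → List Bool := majF A ∘ predArgX mp

/-- **The candidate record** `[pass bit, prediction]`. [folklore] -/
def candF : List Bool → List Bool := fun x => passF mp S A x ++ predF mp A x

/-! ### The selection fold and the answer bit (definitions) -/

/-- **The selection operation** on `⟨acc, rec⟩`: keep `acc` if it passes (head bit `1`), else take `rec` if it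
passes, else keep `acc`. [ImpagliazzoWigderson2001, Lemma 14 ("output the first that passes")] -/
def firstOp : List Bool → List Bool := iteFn (headBitFn ∘ fstF) fstF (iteFn (headBitFn ∘ sndF) sndF fstF)

/-- The initial record of the selection fold on `w₀ = ⟨e, R⟩`: `⟨w₀, ⟨bin (P + 1), ⟨1⁰, []⟩⟩⟩`. [folklore] -/
def selInitF : List Bool → List Bool :=
  fanoutFn (fun w => w) (fanoutFn (lenBinF ∘ List.cons true ∘ PU mp ∘ fstF) (fanoutFn (fun _ => []) fun _ => []))

/-- **The answer bit** of the uniform scheme: the second symbol of the record of the first passing candidate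
(`0` if none passes). [BogdanovTrevisan2006, Def. 2.12; ImpagliazzoWigderson2001, Lemma 14] -/
def outBitF : List Bool → List Bool :=
  headBitFn ∘ List.tail ∘ sndPow 2 ∘ foldLoop firstOp (candF mp S A) (mp.Pp + 1) ∘ selInitF mp

/-- **The uniform scheme** `U(y, 1ⁿ, 1ᵐ)`: the labelled self-testing experiment `out` at the parameters
`pm n m`, with the HONEST POLYNOMIAL coin budget `MParams.coins` (of the input length).
[BogdanovTrevisan2006, Def. 2.12–2.13] [ImpagliazzoWigderson2001, Lemma 14] -/
def uScheme (mp' : MParams) (S' : Bool → RandAlg ℕ (List Bool)) (A' : RandAlg (List Bool × ℕ × ℕ) Bool) :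
    RandAlg (List Bool × ℕ × ℕ) Bool where
  run q R := out A' S' (mp'.pm q.2.1 q.2.2) q.1 R
  coinLen ℓ := mp'.coins.eval ℓ

section XValues

variable (y R : List Bool) (n m c : ℕ)

/-- **Value of the error count.** [folklore] -/
theorem errSumF_apply : errSumF mp S A (boolPair (boolPair (schemeEnc (y, n, m)) R) (ones c)) =
    encodeNat (errCount A S (mp.pm n m) c R) := by
  have hK : ((NU mp ∘ eX) (boolPair (boolPair (schemeEnc (y, n, m)) R) (ones c))).length ≤
      mp.Np.eval (boolPair (boolPair (schemeEnc (y, n, m)) R) (ones c)).length := by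
    simp only [Function.comp_apply, eX, fstF_boolPair, NU_schemeEnc, List.length_replicate, MParams.pm, MParams.params]
    refine TM2Iter.eval_mono _ ?_
    simp only [length_boolPair, length_schemeEnc, List.length_nil]
    omega
  rw [errSumF, sumF_apply _ _ hK, errCount]
  simp only [Function.comp_apply, eX, fstF_boolPair, NU_schemeEnc, List.length_replicate, errPieceZ_apply,
    bitsToNat_singleton]

/-- **Value of the pass bit**: `[passes c]`. [folklore] -/
theorem passF_apply : passF mp S A (boolPair (boolPair (schemeEnc (y, n, m)) R) (ones c)) =
    [passes A S (mp.pm n m) R c] := by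
  have hlt : (ltFn ∘ fanoutFn (lenBinF ∘ τU mp ∘ eX) (errSumF mp S A)) (boolPair (boolPair (schemeEnc (y, n, m)) R) (ones c)) =
      [decide ((mp.pm n m).τ < errCount A S (mp.pm n m) c R)] := by
    simp only [Function.comp_apply, fanoutFn_apply, eX, fstF_boolPair, τU_schemeEnc, lenBinF_apply,
      List.length_replicate, errSumF_apply, ltFn_boolPair, bitsToNat_encodeNat]
  rw [passF, notFn_apply hlt, passes]
  by_cases h : errCount A S (mp.pm n m) c R ≤ (mp.pm n m).τ
  · simp [h, not_lt.2 h]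
  · simp [h, not_le.1 h]

/-- Value of `outZX`: the output block. [folklore] -/
theorem outZX_apply : outZX mp (boolPair (boolPair (schemeEnc (y, n, m)) R) (ones c)) = outZ (mp.pm n m) R := by
  simp only [outZX, eX, rX, Function.comp_apply, fanoutFn_apply, fstF_boolPair, sndF_boolPair, kPU_schemeEnc,
    testLenU_schemeEnc, dropFn_boolPair, takeFn_boolPair, List.length_replicate, outZ]

/-- **Value of the prediction**: the selected-style vote `[maj (query y) c k (outZ R)]`. [folklore] -/
theorem predF_apply : predF mp A (boolPair (boolPair (schemeEnc (y, n, m)) R) (ones c)) =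
    [maj A (query (mp.pm n m).G n y) c (mp.pm n m).k (outZ (mp.pm n m) R)] := by
  rw [predF, Function.comp_apply, predArgX, fanoutFn_apply, fanoutFn_apply, fanoutFn_apply, outZX_apply]
  simp only [Function.comp_apply, eX, fstF_boolPair, sndF_boolPair, fanoutFn_apply, fstF_schemeEnc, qOfF_apply,
    kU_schemeEnc, majF_apply]

/-- **Value of the candidate record**: `[passes c, vote]`. [folklore] -/
theorem candF_apply : candF mp S A (boolPair (boolPair (schemeEnc (y, n, m)) R) (ones c)) =
    [passes A S (mp.pm n m) R c, maj A (query (mp.pm n m).G n y) c (mp.pm n m).k (outZ (mp.pm n m) R)] := by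
  rw [candF, passF_apply, predF_apply]
  rfl

end XValues

/-- The pass bit is one-bit. [folklore] -/
theorem oneBit_passF : OneBit (passF mp S A) := oneBit_notFn (oneBit_ltFn.comp _)

/-- The prediction is one-bit. [folklore] -/
theorem oneBit_predF : OneBit (predF mp A) := (oneBit_majF A).comp _

/-- The candidate record has two symbols on every input. [folklore] -/
theorem length_candF (x : List Bool) : (candF mp S A x).length = 2 := by
  rw [candF, List.length_append, (oneBit_passF mp S A).length_eq, (oneBit_predF mp A).length_eq]

/-- Growth of the candidate record: linear (constant `2`). [folklore] -/
theorem length_candF_le (x : List Bool) : (candF mp S A x).length ≤ 2 * ((fstF x).length + 1) := by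
  rw [length_candF]
  omega

variable {S A}

/-- `errSumF ∈ FP`. [AroraBarak2009, §1.3 (bounded loops)] -/
theorem errSumF_mem_FP (hS : ∀ b, (S b).IsPolyTime unaryEncodeNat (id : List Bool → List Bool))
    (hA : A.IsPolyTime schemeEnc encodeBool) : errSumF mp S A ∈ FP :=
  sumF_mem_FP (errPieceZ_mem_FP mp hS hA) (length_le_of_oneBit (oneBit_errPieceZ mp S A))
    (comp_mem_FP (polyFn_stripF_mem_FP _) (comp_mem_FP fstF_mem_FP fstF_mem_FP)) mp.Np

/-- `passF ∈ FP`. [folklore] -/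
theorem passF_mem_FP (hS : ∀ b, (S b).IsPolyTime unaryEncodeNat (id : List Bool → List Bool))
    (hA : A.IsPolyTime schemeEnc encodeBool) : passF mp S A ∈ FP :=
  notFn_mem_FP (comp_mem_FP ltFn_mem_FP (fanoutFn_mem_FP
    (comp_mem_FP lenBinF_mem_FP (comp_mem_FP (polyFn_stripF_mem_FP _) (comp_mem_FP fstF_mem_FP fstF_mem_FP)))
    (errSumF_mem_FP mp hS hA)))

/-- `predF ∈ FP`. [folklore] -/
theorem predF_mem_FP (hA : A.IsPolyTime schemeEnc encodeBool) : predF mp A ∈ FP := by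
  have heX : eX ∈ FP := comp_mem_FP fstF_mem_FP fstF_mem_FP
  have hout : outZX mp ∈ FP :=
    comp_mem_FP takeFn_mem_FP (fanoutFn_mem_FP (comp_mem_FP (kPU_mem_FP mp) heX)
      (comp_mem_FP dropFn_mem_FP (fanoutFn_mem_FP (comp_mem_FP (testLenU_mem_FP mp) heX)
        (comp_mem_FP sndF_mem_FP fstF_mem_FP))))
  have harg : predArgX mp ∈ FP :=
    fanoutFn_mem_FP (comp_mem_FP (qOfF_mem_FP mp) (fanoutFn_mem_FP (comp_mem_FP fstF_mem_FP heX) heX))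
      (fanoutFn_mem_FP sndF_mem_FP (fanoutFn_mem_FP (comp_mem_FP (polyFn_stripF_mem_FP _) heX) hout))
  exact comp_mem_FP (majF_mem_FP hA) harg

/-- `candF ∈ FP`. [folklore] -/
theorem candF_mem_FP (hS : ∀ b, (S b).IsPolyTime unaryEncodeNat (id : List Bool → List Bool))
    (hA : A.IsPolyTime schemeEnc encodeBool) : candF mp S A ∈ FP :=
  append_mem_FP (passF_mem_FP mp hS hA) (predF_mem_FP mp hA)

/-! ### The selection fold: keep the record of the first passing candidate -/

/-- Value of `firstOp` on a pair. [folklore] -/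
theorem firstOp_boolPair (a p : List Bool) :
    firstOp (boolPair a p) = if a.headD false then a else if p.headD false then p else a := by
  have h1 : (headBitFn ∘ fstF) (boolPair a p) = [a.headD false] := by simp
  have h2 : (headBitFn ∘ sndF) (boolPair a p) = [p.headD false] := by simp
  rw [firstOp, iteFn_apply h1, iteFn_apply h2, fstF_boolPair, sndF_boolPair]

/-- Growth of `firstOp`: it returns one of its two fields. [folklore] -/
theorem length_firstOp_le (w : List Bool) : (firstOp w).length ≤ (fstF w).length + (sndF w).length + 0 := by
  rw [firstOp, iteFn_of_oneBit (oneBit_headBitFn.comp _)]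
  split_ifs
  · omega
  · rw [iteFn_of_oneBit (oneBit_headBitFn.comp _)]
    split_ifs <;> omega

/-- `firstOp ∈ FP`. [folklore] -/
theorem firstOp_mem_FP : firstOp ∈ FP :=
  iteFn_mem_FP (comp_mem_FP HashBricks.headBitFn_mem_FP fstF_mem_FP) fstF_mem_FP
    (iteFn_mem_FP (comp_mem_FP HashBricks.headBitFn_mem_FP sndF_mem_FP) sndF_mem_FP fstF_mem_FP)

/-- **The model of the selection fold**: from the empty accumulator, `K` rounds leave the record of the first
index `j < K` whose record passes (head bit `1`), or the empty record. [folklore] -/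
theorem foldAcc_firstOp (f : List Bool → List Bool) (x : List Bool) : ∀ K : ℕ,
    foldAcc firstOp f x 0 K [] =
      match (List.range K).find? (fun j => (f (boolPair x (ones j))).headD false) with
      | some j => f (boolPair x (ones j))
      | none => []
  | 0 => by simp
  | K + 1 => by
    rw [foldAcc_succ', foldAcc_firstOp f x K, zero_add, List.range_succ, List.find?_append]
    cases h : (List.range K).find? (fun j => (f (boolPair x (ones j))).headD false) with
    | some j =>
      have hj : (f (boolPair x (ones j))).headD false = true := by
        have := List.find?_some h
        simpa using this
      simp only [Option.some_or, firstOp_boolPair, hj, if_true]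
    | none =>
      simp only [Option.none_or, List.find?_singleton, firstOp_boolPair, List.headD_nil, Bool.false_eq_true,
        if_false]
      split_ifs <;> rfl

/-! ### The answer bit -/

/-- **Value of the answer bit**: `[out (pm n m) y R]`. [folklore] -/
theorem outBitF_apply (y R : List Bool) (n m : ℕ) :
    outBitF mp S A (boolPair (schemeEnc (y, n, m)) R) = [out A S (mp.pm n m) y R] := by
  have hinit : selInitF mp (boolPair (schemeEnc (y, n, m)) R) = boolPair (boolPair (schemeEnc (y, n, m)) R)
      (boolPair (encodeNat ((mp.pm n m).P + 1)) (boolPair (ones 0) [])) := by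
    simp [selInitF, PU_schemeEnc, ones]
  have hk : (mp.pm n m).P + 1 ≤ (mp.Pp + 1).eval (boolPair (schemeEnc (y, n, m)) R).length := by
    simp only [eval_add, eval_one, MParams.pm, MParams.params, add_le_add_iff_right]
    refine TM2Iter.eval_mono _ ?_
    simp only [length_boolPair, length_schemeEnc, List.length_nil]
    omega
  rw [outBitF]
  simp only [Function.comp_apply]
  rw [hinit, foldLoop_apply firstOp _ hk 0 [], sndPow_succ_boolPair, sndPow_succ_boolPair, sndPow_zero_boolPair,
    foldAcc_firstOp]
  simp only [candF_apply, List.headD_cons]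
  rw [out, show (fun j => passes A S (mp.pm n m) R j) = passes A S (mp.pm n m) R from rfl, ← sel]
  cases sel A S (mp.pm n m) R <;> simp

/-- `selInitF ∈ FP`. [folklore] -/
theorem selInitF_mem_FP : selInitF mp ∈ FP :=
  fanoutFn_mem_FP OracleCompose.id_mem_FP (fanoutFn_mem_FP
    (comp_mem_FP lenBinF_mem_FP (comp_mem_FP (cons_mem_FP true) (comp_mem_FP (polyFn_stripF_mem_FP _) fstF_mem_FP)))
    (fanoutFn_mem_FP (const_mem_FP _) (const_mem_FP _)))

/-- **The answer bit is in `FP`** for polynomial-time samplers and scheme. [AroraBarak2009, §1.3] -/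
theorem outBitF_mem_FP (hS : ∀ b, (S b).IsPolyTime unaryEncodeNat (id : List Bool → List Bool))
    (hA : A.IsPolyTime schemeEnc encodeBool) : outBitF mp S A ∈ FP :=
  comp_mem_FP HashBricks.headBitFn_mem_FP (comp_mem_FP PRelSigma.tail_mem_FP (comp_mem_FP (sndPow_mem_FP 2)
    (comp_mem_FP (foldLoop_mem_FP firstOp_mem_FP length_firstOp_le (candF_mem_FP mp hS hA) (length_candF_le mp S A) _)
      (selInitF_mem_FP mp))))

/-! ### The uniform scheme -/

/-- The coin budget of the uniform scheme is the polynomial `coins`. [folklore] -/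
theorem uScheme_coinLen (ℓ : ℕ) : (uScheme mp S A).coinLen ℓ = mp.coins.eval ℓ := rfl

/-- **The uniform scheme is probabilistic polynomial time** (its run map on machine words is `outBitF`).
[AroraBarak2009, §1.3, Def. 7.1] -/
theorem uScheme_isPolyTime (hS : ∀ b, (S b).IsPolyTime unaryEncodeNat (id : List Bool → List Bool))
    (hA : A.IsPolyTime schemeEnc encodeBool) : (uScheme mp S A).IsPolyTime schemeEnc encodeBool := by
  refine ⟨PolyTimeComputable.of_encode_eq (f := outBitF mp S A) (ea := id) (eb := id)
      (fun p : (List Bool × ℕ × ℕ) × List Bool => boolPair (schemeEnc p.1) p.2) (fun _ => rfl)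
      (fun p => ?_) (outBitF_mem_FP mp hS hA), mp.coins, fun ℓ => le_rfl⟩
  obtain ⟨⟨y, n, m⟩, R⟩ := p
  rw [id, outBitF_apply]
  rfl

/-- **The error probability of the uniform scheme** on `(y, 1ⁿ, 1ᵐ)` about a target bit is the counting
probability, over the `total` coins actually read, of the event `out(y; R) ≠ target` (the budget covers the
coins read, `MParams.total_pm_le`; the answer depends on a prefix, `out_take`). [AroraBarak2009, §7.1] -/
theorem uScheme_pr_ne (y : List Bool) (n m : ℕ) (lab : Bool) :
    (uScheme mp S A).pr schemeEnc (y, n, m) {b | b ≠ lab} =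
      uniformProb (mp.pm n m).total {R | out A S (mp.pm n m) y R ≠ lab} := by
  rw [RandAlg.pr_eq_uniformProb, uScheme_coinLen]
  have hset : {R : List Bool | (uScheme mp S A).run (y, n, m) R ∈ {b | b ≠ lab}} =
      {R | R.take (mp.pm n m).total ∈ {R' : List Bool | out A S (mp.pm n m) y R' ≠ lab}} := by
    ext R
    simp only [Set.mem_setOf_eq, uScheme, out_take]
  rw [hset, uniformProb_take_of_le (mp.total_pm_le y n m)]

end AdviceElim

/-- **Registered sub-goal of this file**: the error probability of the uniform scheme on `(y, 1ⁿ, 1ᵐ)` is the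
counting probability of `{R | out(y; R) ≠ target}` over the coins read (`AdviceElim.uScheme_pr_ne`).
[BogdanovTrevisan2006, Def. 2.12; AroraBarak2009, §7.1] -/
theorem adviceElim_uScheme_pr_ne (mp : AdviceElim.MParams) (S : Bool → RandAlg ℕ (List Bool))
    (A : RandAlg (List Bool × ℕ × ℕ) Bool) (y : List Bool) (n m : ℕ) (lab : Bool) :
    (AdviceElim.uScheme mp S A).pr schemeEnc (y, n, m) {b | b ≠ lab} =
      uniformProb (mp.pm n m).total {R | AdviceElim.out A S (mp.pm n m) y R ≠ lab} :=
  AdviceElim.uScheme_pr_ne mp y n m lab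

end Summit.PneNP.PneNP.Cruxes.PeaWorstToAvg.DualModeCompile

end
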